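import Literature.Computability.Cryptography.HallgrenPellQuantum
import Literature.Computability.Cryptography.HallgrenPellPlainProofs
import HarnessLib

/-!
# Hallgren's theorem: `Hallgren2007_regulator_qsolvable` discharged

Topic `Computability/Cryptography`; the one-line consequence of the assembly
`Hallgren2007_regulator_qsolvable_delim_holds` (`HallgrenPellQuantum.lean`) and the reduction of the
prefix form to the self-delimiting form `Hallgren2007_regulator_qsolvable_of_delim`
(`HallgrenPellPlainProofs.lean`). Theorem-only file.

## References

* R. Jozsa, arXiv:quant-ph/0302134 (2003), §10 Thm. 7. [Jozsa2003]
* S. Hallgren, J. ACM 54 (2007), Art. 4. [Hallgren2007]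
-/

namespace Literature.Computability.Cryptography

/-- **Hallgren's theorem** (Jozsa 2003, Thm. 7; Hallgren 2002/2007): the integer part of the
regulator of `ℚ(√d)` is computable in quantum polynomial time. [cite: Jozsa2003, §10 Thm. 7] [cite: Hallgren2007] -/
theorem Hallgren2007_regulator_qsolvable_holds : Hallgren2007_regulator_qsolvable :=
  Hallgren2007_regulator_qsolvable_of_delim Hallgren2007_regulator_qsolvable_delim_holds

end Literature.Computability.Cryptography
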